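import Summits.ResolutionOfSingularities.ResolutionOfSingularities.Theorems.HilbertSamuelEliminationSigmaMaxModificationsCorridor3CPFramePropagationAdapted
import Summits.ResolutionOfSingularities.ResolutionOfSingularities.Theorems.HilbertSamuelEliminationSigmaMaxModificationsCorridor3CPFrameMenuFaceReading
import Summits.ResolutionOfSingularities.ResolutionOfSingularities.Theorems.HilbertSamuelEliminationSigmaMaxModificationsCorridor3SigmaMenuDefs
import Literature.AlgebraicGeometry.Resolution.SncSaturatedCentre
import Mathlib.RingTheory.Flat.FaithfullyFlat.Algebra
import HarnessLib

/-!
# [OURS · L1 W4.2] D18 (G8) ALONG THE CHAIN: E-ADAPTED complete minimal CP frames with `δ ≥ 1` exist at EVERY stage reached along the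
# boundary-threaded canonical sequence — modulo ONE binder, «the frame of the stage reads each canonical centre as a legal face»
# (cell res-hironaka, LADDER-RESOLUTION rung L; slot W4.2, crux chain w42 `SigmaMaxModificationsCorridor3` stmt-ResolutionOfSingularities-19249;
# `--supports stmt-ResolutionOfSingularities-19249 --as helper`; res-L1-w42-plan-1 RULING v3.14-42 part 2 (KG)(2) «(G8) → (G7) → hread_menu»;
# hand res-D-brk-3 (gen 7), files F3b + F3c of DESIGN 17:06:09Z)

SCHEME-SIDE BOOKKEEPING (universe `0`), 0 `def`s, every declaration PROVED; OURS; NOT a statement of Hironaka's manuscript [Hironaka2017] nor of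
[CossartJannsenSaito2020]/[CossartPiltant2019]. AI-written, weaker than expert review.

INVARIANT `H_E(s)` for a marked stage WITH BOUNDARY `s : MarkedStageE` (o1's `…SigmaBoundaryDefs`): «there is a CP frame `(R, u, h, φ)` of `s` over a
COMPLETE base with `coeff_i h ∈ 𝔪_R^{m−i}` (`δ ≥ 1`) and a READING `e : IdealSheafData ↦ Fin 3` such that every boundary member `I` through `x_n`
(067's `Sigma.membersThrough s.E s.pt`) has `(𝓘_{I,x_n})·B = (ū_{e I})`» — an E-ADAPTED frame (CP 2019 Def. 2.6).

* **`exists_isCPFrame_adapted_of_reachesσE`** — along `ReachesσE (Strategy.cjs R₀).withBoundary 3 ν ⟨init X₀ x, E₀⟩ s` (the CJS canonical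
  near steps from a maximal origin with functional admissible oracle, boundary threaded by `Boundary.next`): `H_E(init, E₀)` and the binder
  `hread` («at every reached stage, for every canonical centre `C`, EVERY frame witnessing `H_E` reads `C` as `V(X, u_T)` legally for some `T`»)
  give `H_E(s)` at every reached `s`. Step = `IsCPFrame.exists_isCPFrame_blowup_adapted` (p-PropagationAdapted): the exceptional divisor reads
  `(u'_{j₀})`, the transform of an old member through `x'` reads `(u'_j)` with its OLD index `j` — so the new reading is `e' := e` on transforms and
  `j₀` on the exceptional member (`Boundary.mem_next_iff`, `Boundary.support_memberTransform_subset`).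

* **`exists_isCPFrame_adapted_of_reachesσE_of_faces`** (F3c, `hread_menu` DISCHARGED) — the binder replaced by the σ-design's own constraint
  at the marked points: every canonical centre `C` at a reached stage is PERMISSIBLE at `x_n` and is a FACE of the boundary there — some finite set
  `K` of members through `x_n` with pairwise distinct stalks, `𝓘_{I} ≤ 𝓘_{C}` for `I ∈ K`, and `dim 𝒪_{x_n}/𝓘_C + |K| = 3` (the point: `K` =
  three members … or see `reading_of_face_univ`; member curves: `|K| = 2`; member surfaces: `|K| = 1`) — plus (i) «the stalks are
  equicharacteristic» (`n = 0` or a unit in `𝒪_{X_n,x_n}`; the stages are schemes over a field) and (ii) the PROJECTED-MINIMALITY statement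
  (CP 2019 Prop. 2.4 (2), fact candidate `CossartPiltant2019_prop_2_4_projection`, spelled inline; used only when `|K| ≠ 2`). Proof: in the
  E-adapted frame the face is `T = e(K)` (`|T| = |K|` by faithful flatness of `φ`), and `…CPFrameMenuFaceReading` reads it legally.

References: CP 2019 Def. 2.6–2.7, Prop. 2.7 [CossartPiltant2019]; CJS LNM 2270 Rem. 6.29 (1) [CossartJannsenSaito2020]; Kollár 2007 Def. 3.65
[Kollar2007].
-/

noncomputable section

set_option linter.dupNamespace false

open CategoryTheory AlgebraicGeometry TopologicalSpace IsLocalRing Polynomial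
open Literature.AlgebraicGeometry.Resolution
open Summit.ResolutionOfSingularities.ResolutionOfSingularities.Theorems.CampaignW42
open Summit.ResolutionOfSingularities.ResolutionOfSingularities.Theorems.SigmaMaxModificationsCorridor3.Sigma
open Summit.ResolutionOfSingularities.ResolutionOfSingularities.Theorems.SigmaMaxModificationsCorridor3.Helpers

namespace Summit.ResolutionOfSingularities.ResolutionOfSingularities.Theorems.SigmaMaxModificationsCorridor3.Moving

/-- The boundary-threaded CJS chain projects to the CJS chain of marked stages. [folklore] -/
theorem reaches_of_reachesσE_cjs {R₀ : ∀ S : Scheme.{0}, CentreSeq S → Prop} {N : ℕ} {ν : ℕ → ℕ} {s s' : MarkedStageE.{0}}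
    (h : ReachesσE (Strategy.cjs R₀).withBoundary N ν s s') : Reaches R₀ N ν s.toMarkedStage s'.toMarkedStage :=
  (reachesσ_cjs_iff R₀ N ν _ _).mp h.toMarkedStage

set_option maxHeartbeats 400000 in
/-- [OURS · L1 W4.2] **E-adapted CP frames along the boundary-threaded canonical chain, modulo the face-reading binder.** See the module
docstring. [cite: CossartPiltant2019, Def. 2.6–2.7 and Prop. 2.7 (arXiv v1 p. 14)] [cite: CossartJannsenSaito2020, Rem. 6.29 (1)] -/
theorem exists_isCPFrame_adapted_of_reachesσE {p : ℕ} {R₀ : ∀ S : Scheme.{0}, CentreSeq S → Prop}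
    (hRf : OracleFunctional R₀) (hRa : OracleAdmissible R₀) {ν : ℕ → ℕ} {X₀ : Scheme.{0}} [IsLocallyNoetherian X₀] {x : X₀}
    (hX : IsMaximalOrigin p 3 ν X₀ x) (E₀ : Boundary X₀)
    (hread : ∀ s : MarkedStageE.{0}, ReachesσE (Strategy.cjs R₀).withBoundary 3 ν (MarkedStageE.init X₀ x E₀) s →
      ∀ (C : s.W.IdealSheafData) (P' : Option (Pending (blowup C))), IsCanonicalStep R₀ 3 ν s.L s.P C P' →
      ∀ (R : Type) (_ : CommRing R) (_ : IsLocalRing R) (u : Fin 3 → R) (h : R[X])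
        (φ : (s.W.presheaf.stalk s.pt : Type) →+* R[X] ⧸ Ideal.span {h}) (e : s.W.IdealSheafData → Fin 3),
        IsCPFrame s.toMarkedStage R u h φ → IsAdicComplete (maximalIdeal R) R →
        (∀ i < h.natDegree, h.coeff i ∈ maximalIdeal R ^ (h.natDegree - i)) →
        (∀ I ∈ membersThrough s.E s.pt, (stalkIdeal I s.pt).map φ = Ideal.span {Ideal.Quotient.mk _ (Polynomial.C (u (e I)))}) →
        ∃ T : Finset (Fin 3),
          (stalkIdeal C s.pt).map φ =
            ((Ideal.span (u '' ↑T)).map (Polynomial.C : R →+* R[X]) ⊔ Ideal.span {X}).map (Ideal.Quotient.mk (Ideal.span {h})) ∧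
          ∀ i ∈ Finset.Icc 1 h.natDegree, h.coeff (h.natDegree - i) ∈ Ideal.span (u '' ↑T) ^ i)
    (h0 : ∃ (R : Type) (_ : CommRing R) (_ : IsLocalRing R) (u : Fin 3 → R) (h : R[X])
      (φ : ((MarkedStageE.init X₀ x E₀).W.presheaf.stalk (MarkedStageE.init X₀ x E₀).pt : Type) →+* R[X] ⧸ Ideal.span {h})
      (e : (MarkedStageE.init X₀ x E₀).W.IdealSheafData → Fin 3),
      IsCPFrame (MarkedStageE.init X₀ x E₀).toMarkedStage R u h φ ∧ IsAdicComplete (maximalIdeal R) R ∧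
      (∀ i < h.natDegree, h.coeff i ∈ maximalIdeal R ^ (h.natDegree - i)) ∧
      ∀ I ∈ membersThrough (MarkedStageE.init X₀ x E₀).E (MarkedStageE.init X₀ x E₀).pt,
        (stalkIdeal I (MarkedStageE.init X₀ x E₀).pt).map φ = Ideal.span {Ideal.Quotient.mk _ (Polynomial.C (u (e I)))})
    {s : MarkedStageE.{0}} (hs : ReachesσE (Strategy.cjs R₀).withBoundary 3 ν (MarkedStageE.init X₀ x E₀) s) :
    ∃ (R : Type) (_ : CommRing R) (_ : IsLocalRing R) (u : Fin 3 → R) (h : R[X])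
      (φ : (s.W.presheaf.stalk s.pt : Type) →+* R[X] ⧸ Ideal.span {h}) (e : s.W.IdealSheafData → Fin 3),
      IsCPFrame s.toMarkedStage R u h φ ∧ IsAdicComplete (maximalIdeal R) R ∧
      (∀ i < h.natDegree, h.coeff i ∈ maximalIdeal R ^ (h.natDegree - i)) ∧
      ∀ I ∈ membersThrough s.E s.pt, (stalkIdeal I s.pt).map φ = Ideal.span {Ideal.Quotient.mk _ (Polynomial.C (u (e I)))} := by
  classical
  induction hs with
  | refl => exact h0
  | tail hs' hstep ih =>
    rename_i s₁ s₂
    obtain ⟨R, _, _, u, h, φ, e, hF, hcpl, hco, hE⟩ := ih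
    have hstep' := hstep
    obtain ⟨C, P', hln', x', hσ, hx', hcl, hstr, rfl⟩ := hstep'
    have hcs : IsCanonicalStep R₀ 3 ν s₁.L s₁.P C P' := by
      rw [Strategy.withBoundary_step_iff, Strategy.cjs_step] at hσ
      exact hσ
    obtain ⟨T, hJ, hcoT⟩ := hread _ hs' C P' hcs R inferInstance inferInstance u h φ e hF hcpl hco hE
    haveI : IsLocallyNoetherian s₁.W := s₁.ln
    haveI : IsLocallyNoetherian (blowup C) := hln'
    obtain ⟨R', _, _, u', h', φ', j₀, hF', hcpl', -, hco', -, hexc, hmem⟩ :=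
      hF.exists_isCPFrame_blowup_adapted hRf hRa hX (reaches_of_reachesσE_cjs hs') C P' hln' x' hcs hx' hcl hstr T hJ hcoT
    -- the new reading: transforms keep their index, the exceptional member reads `j₀`
    let e' : (blowup C).IdealSheafData → Fin 3 := fun J =>
      if J = C.comap (blowup.π C) then j₀
      else if hJ : ∃ I, I ∈ membersThrough s₁.E s₁.pt ∧ Boundary.memberTransform C I = J then e hJ.choose else 0
    refine ⟨R', inferInstance, inferInstance, u', h', φ', e', hF', hcpl', hco', fun J hJm => ?_⟩
    obtain ⟨hJE, hxJ⟩ := mem_membersThrough_iff.mp hJm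
    by_cases hJexc : J = C.comap (blowup.π C)
    · -- the exceptional member
      have he' : e' J = j₀ := by simp only [e', hJexc, if_true]
      rw [he', hJexc]
      exact hexc
    · -- the transform of an old member through `x_n`
      rcases (Boundary.mem_next_iff s₁.E C J).mp hJE with ⟨I, hIE, hIJ⟩ | hJ'
      swap
      · exact absurd hJ' hJexc
      have hxI : s₁.pt ∈ (I.support : Set s₁.W) := by
        have := Boundary.support_memberTransform_subset C I (hIJ ▸ hxJ)
        rw [Set.mem_preimage, hx'] at this
        exact this
      have hex : ∃ I, I ∈ membersThrough s₁.E s₁.pt ∧ Boundary.memberTransform C I = J :=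
        ⟨I, mem_membersThrough_iff.mpr ⟨hIE, hxI⟩, hIJ⟩
      have he' : e' J = e hex.choose := by simp only [e', hJexc, if_false, dif_pos hex]
      obtain ⟨hI₁m, hI₁J⟩ := hex.choose_spec
      rcases hmem hex.choose (e hex.choose) (hE _ hI₁m) with htop | ⟨-, hread'⟩
      · -- the transform cannot miss `x'`, which lies on it
        exfalso
        have hne := (mem_support_iff_stalkIdeal_ne_top J x').mp hxJ
        rw [← hI₁J] at hne
        exact hne htop
      · rw [he']
        show (stalkIdeal J x').map φ' = _
        have hJ' : stalkIdeal J x' = stalkIdeal (Boundary.memberTransform C hex.choose) x' := by rw [hI₁J]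
        rw [hJ']
        exact hread'

/-- Naturals that are `0` or units in `𝒪_{x_n}` are `0` or units in the base `R` of any CP frame (`R → R[X]/(h)` is injective and local,
`φ` maps `n` to `n`). [folklore] -/
theorem IsCPFrame.natCast_eq_zero_or_isUnit {s : MarkedStage.{0}} {R : Type} [CommRing R] [IsLocalRing R] {u : Fin 3 → R} {h : R[X]}
    {φ : (s.W.presheaf.stalk s.pt : Type) →+* R[X] ⧸ Ideal.span {h}} (hF : IsCPFrame s R u h φ)
    (hco : ∀ i < h.natDegree, h.coeff i ∈ maximalIdeal R ^ (h.natDegree - i))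
    (hchar : ∀ n : ℕ, (n : (s.W.presheaf.stalk s.pt : Type)) = 0 ∨ IsUnit (n : (s.W.presheaf.stalk s.pt : Type))) (n : ℕ)
    (hn : (n : R) ≠ 0) : IsUnit (n : R) := by
  have hm : 0 < h.natDegree := hF.natDegree_pos
  obtain ⟨hR, hloc, -, hu, hmon, -, -, -, -, -⟩ := hF
  haveI := hR
  haveI : IsLocalRing (R[X] ⧸ Ideal.span {h}) := hloc
  haveI : IsLocalRing (AdjoinRoot h) := hloc
  haveI : IsDomain R := isDomain_of_isRegularLocalRing R
  have hinj : Function.Injective ((Ideal.Quotient.mk (Ideal.span {h})).comp (Polynomial.C : R →+* R[X])) := by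
    refine AdjoinRoot.of.injective_of_degree_ne_zero ?_
    rw [Polynomial.degree_eq_natDegree hmon.ne_zero]
    exact_mod_cast hm.ne'
  rcases hchar n with h0 | hunit
  · exfalso
    apply hn
    apply hinj
    have h1 : ((Ideal.Quotient.mk (Ideal.span {h})).comp (Polynomial.C : R →+* R[X])) (n : R) = (n : R[X] ⧸ Ideal.span {h}) :=
      map_natCast _ n
    have h2 : φ (n : (s.W.presheaf.stalk s.pt : Type)) = (n : R[X] ⧸ Ideal.span {h}) := map_natCast φ n
    rw [h1, map_zero, ← h2, h0, map_zero]
  · have hB : IsUnit ((n : R[X] ⧸ Ideal.span {h})) := by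
      have := hunit.map φ
      rwa [map_natCast] at this
    by_contra hnu
    have hmem : (n : R) ∈ maximalIdeal R := (IsLocalRing.mem_maximalIdeal _).mpr hnu
    have hmemB : ((Ideal.Quotient.mk (Ideal.span {h})).comp (Polynomial.C : R →+* R[X])) (n : R) ∈ maximalIdeal (R[X] ⧸ Ideal.span {h}) := by
      rw [maximalIdeal_quotient_eq_frameIdeal hu hmon hm (fun i hi => Ideal.pow_le_self (by omega) (hco i hi)), RingHom.comp_apply]
      exact Ideal.mem_map_of_mem _ (Ideal.mem_sup_left (Ideal.mem_map_of_mem _ (hu ▸ hmem)))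
    rw [map_natCast] at hmemB
    exact (IsLocalRing.mem_maximalIdeal _).mp hmemB hB

/-- [OURS · L1 W4.2] **`hread_menu` DISCHARGED: E-adapted complete minimal CP frames with `δ ≥ 1` along the boundary-threaded canonical chain,
whenever every canonical centre at the marked points is a permissible FACE of the boundary** (points, member curves, member surfaces), modulo
the equicharacteristic stalks and the projected-minimality statement (CP 2019 Prop. 2.4 (2)) for the non-curve faces. See the module docstring.
[cite: CossartPiltant2019, Def. 2.6–2.7, Prop. 2.3–2.4, Prop. 2.7 (arXiv v1 pp. 11–14)] [cite: CossartJannsenSaito2020, Def. 3.1, Rem. 6.29 (1)] -/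
theorem exists_isCPFrame_adapted_of_reachesσE_of_faces {p : ℕ} {R₀ : ∀ S : Scheme.{0}, CentreSeq S → Prop}
    (hRf : OracleFunctional R₀) (hRa : OracleAdmissible R₀) {ν : ℕ → ℕ} {X₀ : Scheme.{0}} [IsLocallyNoetherian X₀] {x : X₀}
    (hX : IsMaximalOrigin p 3 ν X₀ x) (E₀ : Boundary X₀)
    (hchar : ∀ s : MarkedStageE.{0}, ReachesσE (Strategy.cjs R₀).withBoundary 3 ν (MarkedStageE.init X₀ x E₀) s →
      ∀ n : ℕ, (n : (s.W.presheaf.stalk s.pt : Type)) = 0 ∨ IsUnit (n : (s.W.presheaf.stalk s.pt : Type)))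
    (hproj : ∀ (R : Type) (_ : CommRing R) (_ : IsRegularLocalRing R) (u : Fin 3 → R) (h : R[X]),
      Ideal.span (Set.range u) = maximalIdeal R → h.Monic → CossartPiltant.IsMinimal u h →
      ∀ T : Finset (Fin 3), CossartPiltant.IsMinimal (u ∘ (fun i => T.orderEmbOfFin rfl i)) h)
    (hface : ∀ s : MarkedStageE.{0}, ReachesσE (Strategy.cjs R₀).withBoundary 3 ν (MarkedStageE.init X₀ x E₀) s →
      ∀ (C : s.W.IdealSheafData) (P' : Option (Pending (blowup C))), IsCanonicalStep R₀ 3 ν s.L s.P C P' →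
      IdealSheafData.IsPermissibleAt C s.pt ∧
      ∃ K : Finset s.W.IdealSheafData, (∀ I ∈ K, I ∈ membersThrough s.E s.pt ∧ stalkIdeal I s.pt ≤ stalkIdeal C s.pt) ∧
        (∀ I ∈ K, ∀ I' ∈ K, stalkIdeal I s.pt = stalkIdeal I' s.pt → I = I') ∧
        ringKrullDim ((s.W.presheaf.stalk s.pt : Type) ⧸ stalkIdeal C s.pt) + K.card = 3)
    (h0 : ∃ (R : Type) (_ : CommRing R) (_ : IsLocalRing R) (u : Fin 3 → R) (h : R[X])
      (φ : ((MarkedStageE.init X₀ x E₀).W.presheaf.stalk (MarkedStageE.init X₀ x E₀).pt : Type) →+* R[X] ⧸ Ideal.span {h})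
      (e : (MarkedStageE.init X₀ x E₀).W.IdealSheafData → Fin 3),
      IsCPFrame (MarkedStageE.init X₀ x E₀).toMarkedStage R u h φ ∧ IsAdicComplete (maximalIdeal R) R ∧
      (∀ i < h.natDegree, h.coeff i ∈ maximalIdeal R ^ (h.natDegree - i)) ∧
      ∀ I ∈ membersThrough (MarkedStageE.init X₀ x E₀).E (MarkedStageE.init X₀ x E₀).pt,
        (stalkIdeal I (MarkedStageE.init X₀ x E₀).pt).map φ = Ideal.span {Ideal.Quotient.mk _ (Polynomial.C (u (e I)))})
    {s : MarkedStageE.{0}} (hs : ReachesσE (Strategy.cjs R₀).withBoundary 3 ν (MarkedStageE.init X₀ x E₀) s) :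
    ∃ (R : Type) (_ : CommRing R) (_ : IsLocalRing R) (u : Fin 3 → R) (h : R[X])
      (φ : (s.W.presheaf.stalk s.pt : Type) →+* R[X] ⧸ Ideal.span {h}) (e : s.W.IdealSheafData → Fin 3),
      IsCPFrame s.toMarkedStage R u h φ ∧ IsAdicComplete (maximalIdeal R) R ∧
      (∀ i < h.natDegree, h.coeff i ∈ maximalIdeal R ^ (h.natDegree - i)) ∧
      ∀ I ∈ membersThrough s.E s.pt, (stalkIdeal I s.pt).map φ = Ideal.span {Ideal.Quotient.mk _ (Polynomial.C (u (e I)))} := by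
  classical
  refine exists_isCPFrame_adapted_of_reachesσE hRf hRa hX E₀ (fun s₁ hs₁ C P' hcs R _ _ u h φ e hF hcpl hco hE => ?_) h0 hs
  obtain ⟨hperm, K, hK, hKinj, hdimK⟩ := hface s₁ hs₁ C P' hcs
  have hF' := hF
  obtain ⟨hR, hloc, hdim, hu, hmon, hφl, hflat, hmap, -, hmin⟩ := hF'
  haveI := hR
  haveI : IsLocalRing (AdjoinRoot h) := hloc
  -- the face indices `T = e(K)`; `e` is injective on `K` (faithful flatness of `φ`)
  letI algφ : Algebra (s₁.W.presheaf.stalk s₁.pt : Type) (R[X] ⧸ Ideal.span {h}) := φ.toAlgebra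
  haveI : Module.Flat (s₁.W.presheaf.stalk s₁.pt : Type) (R[X] ⧸ Ideal.span {h}) := hflat
  haveI : IsLocalHom (algebraMap (s₁.W.presheaf.stalk s₁.pt : Type) (R[X] ⧸ Ideal.span {h})) := hφl
  haveI : Module.FaithfullyFlat (s₁.W.presheaf.stalk s₁.pt : Type) (R[X] ⧸ Ideal.span {h}) := Module.FaithfullyFlat.of_flat_of_isLocalHom
  set T : Finset (Fin 3) := K.image e with hTdef
  have heinj : Set.InjOn e ↑K := by
    intro I hI I' hI' hee
    apply hKinj I (Finset.mem_coe.mp hI) I' (Finset.mem_coe.mp hI')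
    have h1 := hE I (hK I (Finset.mem_coe.mp hI)).1
    have h2 := hE I' (hK I' (Finset.mem_coe.mp hI')).1
    rw [← Ideal.comap_map_eq_self_of_faithfullyFlat (B := R[X] ⧸ Ideal.span {h}) (stalkIdeal I s₁.pt),
      ← Ideal.comap_map_eq_self_of_faithfullyFlat (B := R[X] ⧸ Ideal.span {h}) (stalkIdeal I' s₁.pt)]
    change (Ideal.map φ (stalkIdeal I s₁.pt)).comap φ = (Ideal.map φ (stalkIdeal I' s₁.pt)).comap φ
    rw [h1, h2, hee]
  have hTcard : T.card = K.card := Finset.card_image_of_injOn heinj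
  have hT : ∀ t ∈ T, Ideal.Quotient.mk (Ideal.span {h}) (Polynomial.C (u t)) ∈ (stalkIdeal C s₁.pt).map φ := by
    intro t ht
    obtain ⟨I, hIK, rfl⟩ := Finset.mem_image.mp ht
    have h1 := hE I (hK I hIK).1
    exact Ideal.map_mono (hK I hIK).2 (h1 ▸ Ideal.mem_span_singleton_self _)
  have hdimC : ringKrullDim ((s₁.W.presheaf.stalk s₁.pt : Type) ⧸ stalkIdeal C s₁.pt) + T.card = 3 := by rw [hTcard]; exact hdimK
  by_cases hT2 : T.card = 2
  · exact ⟨T, hF.exists_reading_of_face_two (hF.natCast_eq_zero_or_isUnit hco (hchar s₁ hs₁)) hco C hperm T hT2 hT hdimC⟩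
  · exact ⟨T, hF.exists_reading_of_face_of_isMinimal_comp hco C hperm T hT hdimC (hproj R inferInstance hR u h hu hmon hmin T)⟩

end Summit.ResolutionOfSingularities.ResolutionOfSingularities.Theorems.SigmaMaxModificationsCorridor3.Moving

end
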